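import Mathlib
import Summits.ValiantsHypothesis.ValiantsHypothesis.Theorems.LacunarySymmetroidMatrixDescartesDefiniteMomentsZonesCorollaries

/-!
# `MatrixDescartes` (stmt-ValiantsHypothesis-18050) — the DEFINITE-MOMENTS LAW, zones XI: the bound `(K−1)·m` is ATTAINED on
# the intrinsic hyperbolic sector at every format

HONEST FRAMING.  Cell `pub-symmetroid`, seat `val-sym-mdr-p2` (gen 15); helper file `--supports` the crux
`Theses.LacunarySymmetroid.MatrixDescartes`, NO closure claim.  A TIGHTNESS example family for the lacunary Markus theorem
(`card_posRoots_le_of_rayleighSharp`); nothing here bears on the crux in its window, on `stub_twoSided`, on `DoorA26`/`DoorA34`,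
registers, or `VP ≠ VNP`.

THEOREM (`exists_rayleighSharp_tight`).  For all `m` and `K ≥ 2` there is a real symmetric `m × m` lacunary pencil with `K`
letters at the exponents `0, 1, …, K−1` which is Rayleigh-sharp and whose determinant has EXACTLY `(K − 1)·m` distinct positive
zeros.  Construction: `F = diag(q₀, …, q_{m−1})`, `qᵢ(x) = ∏_{k<K−1} (x − ((m+1)(k+1) + i))` (integer roots, pairwise distinct,
the `k`-th roots of all `qᵢ` filling the block `[(m+1)(k+1), (m+1)(k+1)+m]`); at the scales `aⱼ = (m+1)(j+1) − ½` every `qᵢ`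
has the sign `(−1)^{K−1−j}`, so `F` is definite with alternating signs at `K` scales and hence Rayleigh-sharp
(`rayleighSharp_of_alternatingScales`); the lower count is the explicit root list, the upper count is the theorem.  So
`max {Z₊(F) : F Rayleigh-sharp of format (m, K)} = (K − 1)·m` EXACTLY, at every format. [folklore]; axioms standard; no
definitions.
-/

-- layout Summits/ValiantsHypothesis/ValiantsHypothesis forces the duplicated namespace component
set_option linter.dupNamespace false

namespace Summit.ValiantsHypothesis.ValiantsHypothesis.Theorems.LacunarySymmetroidMatrixDescartes

open Polynomial Matrix Finset
open scoped BigOperators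

namespace DefiniteMoments

/-! ## §1 Sign of a product of linear factors -/

/-- A product of negative reals has the sign `(−1)^{#factors}`. [folklore] -/
theorem neg_one_pow_card_mul_prod_pos (s : Finset ℕ) (f : ℕ → ℝ) (h : ∀ k ∈ s, f k < 0) :
    0 < (-1 : ℝ) ^ s.card * ∏ k ∈ s, f k := by
  classical
  induction s using Finset.induction_on with
  | empty => simp
  | insert a s ha ih =>
    rw [Finset.prod_insert ha, Finset.card_insert_of_notMem ha, pow_succ]
    have h1 := ih fun k hk => h k (Finset.mem_insert_of_mem hk)
    have h2 := h a (Finset.mem_insert_self a s)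
    have e : (-1 : ℝ) ^ s.card * -1 * (f a * ∏ k ∈ s, f k) = (-f a) * ((-1) ^ s.card * ∏ k ∈ s, f k) := by ring
    rw [e]
    exact mul_pos (neg_pos.2 h2) h1

/-- Sign of `∏_{k<K−1} (y − cₖ)` when `y` lies above `c₀, …, c_{j−1}` and below `cⱼ, …, c_{K−2}`: it is `(−1)^{K−1−j}`.
[folklore] -/
theorem sign_prod_linear (K j : ℕ) (c : ℕ → ℝ) (y : ℝ) (hlo : ∀ k, k < j → c k < y)
    (hhi : ∀ k, j ≤ k → k < K - 1 → y < c k) :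
    0 < (-1 : ℝ) ^ (K - 1 - j) * ∏ k ∈ Finset.range (K - 1), (y - c k) := by
  rw [← Finset.prod_filter_mul_prod_filter_not (Finset.range (K - 1)) (fun k => k < j)]
  have hpos : 0 < ∏ k ∈ (Finset.range (K - 1)).filter (fun k => k < j), (y - c k) :=
    Finset.prod_pos fun k hk => sub_pos.2 (hlo k (Finset.mem_filter.1 hk).2)
  have hcard : ((Finset.range (K - 1)).filter (fun k => ¬ (k < j))).card = K - 1 - j := by
    have e : (Finset.range (K - 1)).filter (fun k => ¬ (k < j)) = Finset.Ico j (K - 1) := by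
      ext k
      simp only [Finset.mem_filter, Finset.mem_range, Finset.mem_Ico]
      omega
    rw [e, Nat.card_Ico]
  have hneg := neg_one_pow_card_mul_prod_pos ((Finset.range (K - 1)).filter (fun k => ¬ (k < j)))
    (fun k => y - c k) (fun k hk => by
      have hk' := Finset.mem_filter.1 hk
      exact sub_neg.2 (hhi k (not_lt.1 hk'.2) (Finset.mem_range.1 hk'.1)))
  rw [hcard] at hneg
  have e : (-1 : ℝ) ^ (K - 1 - j) *
      ((∏ k ∈ (Finset.range (K - 1)).filter (fun k => k < j), (y - c k)) *
        ∏ k ∈ (Finset.range (K - 1)).filter (fun k => ¬ (k < j)), (y - c k))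
      = (∏ k ∈ (Finset.range (K - 1)).filter (fun k => k < j), (y - c k)) *
        ((-1 : ℝ) ^ (K - 1 - j) * ∏ k ∈ (Finset.range (K - 1)).filter (fun k => ¬ (k < j)), (y - c k)) := by
    ring
  rw [e]
  exact mul_pos hpos hneg

/-! ## §2 Diagonal pencils of degree-`(K−1)` polynomials -/

section Diagonal

variable {m K : ℕ}

/-- The evaluated diagonal pencil: the letters `Sₗ = diag((qᵢ).coeff l)` at exponents `0, …, K−1` reassemble
`diag(qᵢ(x))` (each `qᵢ` of degree `< K`). [folklore] -/
theorem eval_pencil_diagonal (q : Fin m → ℝ[X]) (hq : ∀ i, (q i).natDegree < K) (x : ℝ) :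
    (∑ l : Fin K, x ^ (l : ℕ) • Matrix.diagonal (fun i => (q i).coeff l))
      = Matrix.diagonal (fun i => (q i).eval x) := by
  ext i j
  rw [Matrix.sum_apply]
  simp only [Matrix.smul_apply, Matrix.diagonal_apply, smul_eq_mul]
  split_ifs with h
  · rw [Polynomial.eval_eq_sum_range' (hq i), ← Fin.sum_univ_eq_sum_range (fun l => (q i).coeff l * x ^ l) K]
    exact Finset.sum_congr rfl fun l _ => by ring
  · simp

/-- The determinant of the diagonal pencil is the product of the `qᵢ`. [folklore] -/
theorem det_pencil_diagonal (q : Fin m → ℝ[X]) (hq : ∀ i, (q i).natDegree < K) :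
    Matrix.det (∑ l : Fin K, ((X : ℝ[X]) ^ (l : ℕ)) • (Matrix.diagonal (fun i => (q i).coeff l)).map C)
      = ∏ i, q i := by
  have h : (∑ l : Fin K, ((X : ℝ[X]) ^ (l : ℕ)) • (Matrix.diagonal (fun i => (q i).coeff l)).map C)
      = Matrix.diagonal q := by
    refine Matrix.ext fun i j => ?_
    rw [Matrix.sum_apply]
    simp only [Matrix.smul_apply, Matrix.map_apply, Matrix.diagonal_apply, smul_eq_mul]
    split_ifs with hij
    · subst hij
      have e : q i = ∑ l : Fin K, C ((q i).coeff l) * (X : ℝ[X]) ^ (l : ℕ) := by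
        conv_lhs => rw [Polynomial.as_sum_range' (q i) K (hq i)]
        rw [← Fin.sum_univ_eq_sum_range (fun l => (monomial l) ((q i).coeff l)) K]
        exact Finset.sum_congr rfl fun l _ => Polynomial.C_mul_X_pow_eq_monomial.symm
      conv_rhs => rw [e]
      exact Finset.sum_congr rfl fun l _ => by ring
    · simp
  rw [h, Matrix.det_diagonal]

/-- Quadratic form of a diagonal matrix. [folklore] -/
theorem form_diagonal (g v : Fin m → ℝ) :
    v ⬝ᵥ (Matrix.diagonal g *ᵥ v) = ∑ i, g i * (v i * v i) := by
  simp only [dotProduct, Matrix.mulVec_diagonal]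
  exact Finset.sum_congr rfl fun i _ => by ring

end Diagonal

/-! ## §3 The tight family -/

/-- Mixed-radix uniqueness: `(m+1)(k+1) + i = (m+1)(k'+1) + i'` with `i, i' ≤ m` forces `k = k'` and `i = i'`. [folklore] -/
theorem radix_unique {m k k' i i' : ℕ} (hi : i < m + 1) (hi' : i' < m + 1)
    (h : (m + 1) * (k + 1) + i = (m + 1) * (k' + 1) + i') : k = k' ∧ i = i' := by
  have hm : 0 < m + 1 := Nat.succ_pos m
  have h1 : ((m + 1) * (k + 1) + i) / (m + 1) = k + 1 := by
    rw [Nat.mul_add_div hm, Nat.div_eq_of_lt hi, add_zero]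
  have h2 : ((m + 1) * (k' + 1) + i') / (m + 1) = k' + 1 := by
    rw [Nat.mul_add_div hm, Nat.div_eq_of_lt hi', add_zero]
  rw [h] at h1
  have hk : k = k' := by omega
  subst hk
  exact ⟨rfl, by omega⟩

/-- **THE BOUND `(K−1)·m` IS ATTAINED ON THE SECTOR AT EVERY FORMAT.**  For all `m` and `K ≥ 2` there are strictly increasing
exponents (here `0, 1, …, K−1`) and real symmetric `m × m` letters forming a Rayleigh-sharp pencil whose determinant has exactly
`(K − 1)·m` distinct positive zeros. [folklore] -/
theorem exists_rayleighSharp_tight (m K : ℕ) (hK : 2 ≤ K) :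
    ∃ (d : Fin K → ℕ) (S : Fin K → Matrix (Fin m) (Fin m) ℝ), StrictMono d ∧ (∀ l, (S l).IsSymm) ∧
      (∀ v : Fin m → ℝ, v ≠ 0 →
        K ≤ ((∑ l, C (v ⬝ᵥ (S l *ᵥ v)) * (X : ℝ[X]) ^ d l).roots.toFinset.filter (fun t => 0 < t)).card + 1) ∧
      ((Matrix.det (∑ k, ((X : ℝ[X]) ^ d k) • (S k).map C)).roots.toFinset.filter (fun t => 0 < t)).card
        = (K - 1) * m := by
  classical
  -- roots `c i k = (m+1)(k+1) + i`, polynomials `qᵢ = ∏_{k<K−1} (X − c i k)`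
  set c : Fin m → ℕ → ℝ := fun i k => (((m + 1) * (k + 1) + (i : ℕ) : ℕ) : ℝ) with hc
  set q : Fin m → ℝ[X] := fun i => ∏ k ∈ Finset.range (K - 1), ((X : ℝ[X]) - C (c i k)) with hqdef
  have hqdeg : ∀ i, (q i).natDegree < K := by
    intro i
    simp only [hqdef]
    rw [Polynomial.natDegree_prod_of_monic _ _ (fun k _ => Polynomial.monic_X_sub_C _)]
    simp only [Polynomial.natDegree_X_sub_C, Finset.sum_const, Finset.card_range, smul_eq_mul, mul_one]
    omega
  have hq0 : ∀ i, q i ≠ 0 := fun i =>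
    (Polynomial.monic_prod_of_monic _ _ (fun k _ => Polynomial.monic_X_sub_C (c i k))).ne_zero
  have hqeval : ∀ i x, (q i).eval x = ∏ k ∈ Finset.range (K - 1), (x - c i k) := by
    intro i x
    simp only [hqdef, Polynomial.eval_prod, eval_sub, eval_X, eval_C]
  set d : Fin K → ℕ := fun l => (l : ℕ) with hd
  set S : Fin K → Matrix (Fin m) (Fin m) ℝ := fun l => Matrix.diagonal (fun i => (q i).coeff l) with hS
  have hdmono : StrictMono d := fun a b h => h
  have hSsymm : ∀ l, (S l).IsSymm := fun l => Matrix.diagonal_transpose _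
  -- (1) Rayleigh-sharp via the scales `aⱼ = (m+1)(j+1) − ½`
  have hsharp : ∀ v : Fin m → ℝ, v ≠ 0 →
      K ≤ ((∑ l, C (v ⬝ᵥ (S l *ᵥ v)) * (X : ℝ[X]) ^ d l).roots.toFinset.filter (fun t => 0 < t)).card + 1 := by
    set a : Fin (K - 1 + 1) → ℝ := fun j => ((m : ℝ) + 1) * ((j : ℝ) + 1) - 1 / 2 with ha
    have hamono : StrictMono a := by
      intro j j' h
      simp only [ha]
      have h' : (j : ℝ) + 1 < (j' : ℝ) + 1 := by
        have : (j : ℕ) < j' := h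
        exact_mod_cast Nat.succ_lt_succ this
      have hm1 : (0 : ℝ) < (m : ℝ) + 1 := by positivity
      nlinarith
    have ha0 : 0 < a 0 := by
      simp only [ha, Fin.val_zero, Nat.cast_zero, zero_add, mul_one]
      have : (0 : ℝ) ≤ m := Nat.cast_nonneg m
      linarith
    refine rayleighSharp_of_alternatingScales hK d S a hamono ha0 ((-1) ^ (K - 1)) fun j v hv => ?_
    have hjK : (j : ℕ) ≤ K - 1 := by have := j.isLt; omega
    have hpen : (∑ l : Fin K, a j ^ d l • S l) = Matrix.diagonal (fun i => (q i).eval (a j)) := by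
      simp only [hd, hS]
      exact eval_pencil_diagonal q hqdeg (a j)
    rw [hpen, form_diagonal, Finset.mul_sum]
    have hsign : ∀ i, 0 < (-1 : ℝ) ^ (K - 1) * (-1) ^ (j : ℕ) * (q i).eval (a j) := by
      intro i
      have him : ((i : ℕ) : ℝ) ≤ m := by exact_mod_cast (le_of_lt i.isLt)
      have hs := sign_prod_linear K j (c i) (a j) (fun k hk => ?_) (fun k hk1 hk2 => ?_)
      · rw [← hqeval] at hs
        have epar : (-1 : ℝ) ^ (K - 1) * (-1) ^ (j : ℕ) = (-1) ^ (K - 1 - (j : ℕ)) := by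
          rw [← pow_add, neg_one_pow_eq_pow_mod_two, neg_one_pow_eq_pow_mod_two (n := K - 1 - (j : ℕ))]
          congr 1; omega
        rw [epar]
        exact hs
      · -- k < j: c i k = (m+1)(k+1) + i ≤ (m+1)(k+1) + m < (m+1)(j+1) − 1/2
        simp only [hc, ha]
        push_cast
        have hk2 : (k : ℝ) + 2 ≤ (j : ℝ) + 1 := by
          have : k + 2 ≤ (j : ℕ) + 1 := by omega
          exact_mod_cast this
        have hm1 : (0 : ℝ) ≤ (m : ℝ) + 1 := by positivity
        nlinarith [mul_le_mul_of_nonneg_left hk2 hm1]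
      · -- j ≤ k: c i k ≥ (m+1)(k+1) ≥ (m+1)(j+1) > a j
        simp only [hc, ha]
        push_cast
        have hk2 : (j : ℝ) + 1 ≤ (k : ℝ) + 1 := by
          have : (j : ℕ) + 1 ≤ k + 1 := by omega
          exact_mod_cast this
        have hm1 : (0 : ℝ) ≤ (m : ℝ) + 1 := by positivity
        have hi0 : (0 : ℝ) ≤ (i : ℕ) := Nat.cast_nonneg _
        nlinarith [mul_le_mul_of_nonneg_left hk2 hm1]
    obtain ⟨i₀, hi₀⟩ : ∃ i, v i ≠ 0 := by
      by_contra h; push Not at h; exact hv (funext h)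
    apply Finset.sum_pos'
    · intro i _
      have e : (-1 : ℝ) ^ (K - 1) * (-1) ^ (j : ℕ) * ((q i).eval (a j) * (v i * v i))
          = ((-1 : ℝ) ^ (K - 1) * (-1) ^ (j : ℕ) * (q i).eval (a j)) * (v i * v i) := by ring
      rw [e]; exact mul_nonneg (hsign i).le (mul_self_nonneg _)
    · refine ⟨i₀, Finset.mem_univ _, ?_⟩
      have e : (-1 : ℝ) ^ (K - 1) * (-1) ^ (j : ℕ) * ((q i₀).eval (a j) * (v i₀ * v i₀))
          = ((-1 : ℝ) ^ (K - 1) * (-1) ^ (j : ℕ) * (q i₀).eval (a j)) * (v i₀ * v i₀) := by ring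
      rw [e]; exact mul_pos (hsign i₀) (mul_self_pos.2 hi₀)
  -- (2) the determinant and its root count
  have hdet : Matrix.det (∑ k, ((X : ℝ[X]) ^ d k) • (S k).map C) = ∏ i, q i := by
    simp only [hd, hS]; exact det_pencil_diagonal q hqdeg
  refine ⟨d, S, hdmono, hSsymm, hsharp, le_antisymm ?_ ?_⟩
  · have h := card_posRoots_le_of_rayleighSharp hK d hdmono S hSsymm hsharp
    rwa [Fintype.card_fin] at h
  · -- the explicit roots `c i k`, `k < K − 1`, are pairwise distinct positive roots of `∏ qᵢ`
    have hP0 : (∏ i, q i) ≠ 0 := Finset.prod_ne_zero_iff.2 fun i _ => hq0 i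
    set r : Fin m × Fin (K - 1) → ℝ := fun p => c p.1 p.2 with hr
    have hrinj : Function.Injective r := by
      rintro ⟨i, k⟩ ⟨i', k'⟩ h
      simp only [hr, hc] at h
      have h' : (m + 1) * ((k : ℕ) + 1) + (i : ℕ) = (m + 1) * ((k' : ℕ) + 1) + (i' : ℕ) := by exact_mod_cast h
      obtain ⟨hk, hi⟩ := radix_unique (by have := i.isLt; omega) (by have := i'.isLt; omega) h'
      exact Prod.ext (Fin.ext hi) (Fin.ext hk)
    have hsub : Finset.univ.image r ⊆ (∏ i, q i).roots.toFinset.filter (fun t => 0 < t) := by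
      intro x hx
      obtain ⟨⟨i, k⟩, -, rfl⟩ := Finset.mem_image.1 hx
      rw [Finset.mem_filter, Multiset.mem_toFinset, mem_roots hP0, Polynomial.IsRoot, Polynomial.eval_prod]
      refine ⟨Finset.prod_eq_zero (Finset.mem_univ i) ?_, ?_⟩
      · rw [hqeval]
        exact Finset.prod_eq_zero (Finset.mem_range.2 k.isLt) (by simp [hr])
      · simp only [hr, hc]
        exact_mod_cast (by positivity : 0 < (m + 1) * ((k : ℕ) + 1) + (i : ℕ))
    rw [hdet]
    have h := Finset.card_le_card hsub
    rw [Finset.card_image_of_injective _ hrinj, Finset.card_univ, Fintype.card_prod, Fintype.card_fin,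
      Fintype.card_fin] at h
    rwa [mul_comm] at h

end DefiniteMoments

end Summit.ValiantsHypothesis.ValiantsHypothesis.Theorems.LacunarySymmetroidMatrixDescartes
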